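import Mathlib.Algebra.Order.Field.Basic
import Mathlib.Algebra.Order.BigOperators.Group.Finset
import Mathlib.Data.Finset.Lattice.Fold
import Mathlib.Data.Real.Basic
import Mathlib.Tactic.Linarith
import Mathlib.Tactic.Positivity
import Mathlib.Tactic.FieldSimp
import Mathlib.Tactic.Ring
import HarnessLib

/-!
# Volkov 2020 (NPB 961, 115232) §3.2 Lemma 3.4 — the arithmetic of the on-shell denominator bound |W(z)| ≥ C·max_i (z′_i)²/max(z′_i, z_i): the series–parallel drop Z₀ − Z_i = (z″_i)²/(z″_i + z_i), the printed «max ≤ Σ ≤ n·max», and the two-sided comparison (z″)²/(z″ + z) ≍ (z′)²/max(z′, z) that turns one into the other (constants ½ and n²)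

independent recomputation; certified where stated, statistical where stated; no new-physics claim.

CITATION HEADER (venture `QEDPrecision`, cell `pub-qed`, track TROPICAL seat V3b = `pub-qed-trop-v3-lit-2` gen 6; VALUE-FREE: elementary real
inequalities on the SHAPE of a printed proof — no circuit theory, no graph, nothing per word). Third `Volkov2020` companion, after
`UVDegreeHandshake` (ω) and `SpeerFormHalf` (Theorem 3.1 ⇒ (1.9)); serves `tropical/view/V3-VOLKOV-DEGREES.md` §B.9 / B.11.1 row «Lemma 3.4 + (3.3) +
fn 23 “both directions”» — the root of `tropical/theory/T1-EXPONENTS.md` §1.4 / L1 (b) and of ORACLE-RULE (4c)'s «Volkov 2020 L3.4 form».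

Source. [Volkov2020] S. Volkov, Nucl. Phys. B 961 (2020) 115232 = arXiv:1912.04885v4 (e-print tex `iclos_arxiv.tex`, held by the cell under
`pub-qed-trop-v3-lit-2/sources/arxiv-1912.04885/`), §2.2.2 eq. (2.4) (journal p.10; tex l.262–265): "W(z) = m²(Z(z) − Z₀(z)), where Z(z) is the
resistance between the vertexes that are incident to the external lepton lines of the electric circuit with topology G, line resistances z_l;
Z₀(z) = Σ_{l∈Lept(E(G))} z_l is the resistance of the corresponding circuit with removed photon lines." §3.2 Lemma 3.4 (journal p.12; tex
l.362–395): "The following inequality is satisfied [fn 23: This inequality works in both directions too.] for (2.3): |W(z)| ≥ C · max_{i∈Ph(E(G))}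
(z′_i)²/max(z′_i, z_i) (3.3), where z′_i = max_{l∈LPath(i)} z_l, C > 0 is some constant depending only on the structure of the graph (and m)."
PROOF AS PRINTED: "Take i on which the maximum (3.3) is reached. By Z_i(z) we denote the resistance … of the electric circuit with the graph that
is obtained from G by removing all photon lines except i … It is obvious that Z(z) ≤ Z_i(z) ≤ Z₀(z) … Thus, |W(z)| ≥ m²(Z₀(z) − Z_i(z)) =
m²(z″_i − z_i z″_i/(z_i + z″_i)) = m²(z″_i)²/(z″_i + z_i), where z″_i = Σ_{l∈LPath(i)} z_l. The proof is completed taking into account that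
max_{i=1}^n a_i ≤ Σ_{i=1}^n a_i ≤ n · max_{i=1}^n a_i for any a₁,…,a_n ≥ 0."

What the kernel certifies (real numbers; z = the photon's parameter z_i ≥ 0, z″ = the path SUM, z′ = the path MAXIMUM, n = |LPath(i)|):
* `lemma34_parallel_drop` — the displayed identity z″ − z·z″/(z + z″) = (z″)²/(z″ + z) (the photon line z in parallel with the lepton path z″
  lowers the series resistance Z₀ by exactly this amount), and `lemma34_W_ge_drop` — from the printed Z ≤ Z_i ≤ Z₀ with Z_i = Z₀ − z″ + z·z″/(z+z″)
  (taken as HYPOTHESES on reals: Rayleigh monotonicity is circuit theory, not claimed) it follows that |m²(Z − Z₀)| ≥ m²(z″)²/(z″ + z);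
* `lemma34_max_le_sum_le_card_mul_max` — the printed "max a_i ≤ Σ a_i ≤ n·max a_i for a_i ≥ 0" (finite nonempty family), whence z′ ≤ z″ ≤ n·z′;
* the comparison the proof leaves implicit: `sq_div_add_mono` ((a²/(a+z)) is monotone in a > 0 for z ≥ 0), `sq_div_add_le_sq_div_max`
  (a²/(a+z) ≤ a²/max(a,z)) and `sq_div_max_le_two_mul_sq_div_add` (a²/max(a,z) ≤ 2·a²/(a+z)) — max(a,z) ≤ a + z ≤ 2·max(a,z);
* assembled: `lemma34_lower_arith` — 0 < z′ ≤ z″, 0 ≤ z ⇒ (z′)²/max(z′,z) ≤ 2·(z″)²/(z″+z), so (3.3) holds with C = m²/2 once |W| ≥ m²(z″)²/(z″+z)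
  (`lemma34_printed_form`); and the arithmetic half of fn 23's "both directions": `lemma34_upper_arith` — z″ ≤ n·z′ ⇒ (z″)²/(z″+z) ≤ n²·(z′)²/max(z′,z),
  i.e. the two printed quantities m²(z″)²/(z″+z) and (z′)²/max(z′,z) agree up to the constants m²/2 and m²n² (n = the lepton-path length).
NOT claimed: the circuit facts Z ≤ Z_i ≤ Z₀ and W = m²(Z − Z₀) (eq. (2.4)), the converse inequality |W| ≤ C′·max_i (z′_i)²/max(z′_i, z_i) of fn 23
beyond its arithmetic skeleton, eq. (3.4)'s Hepp-sector product form, anything per graph.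
-/

open Finset

namespace Literature.MathematicalPhysics.QuantumFieldTheory.Volkov2020

/-! ## The series–parallel drop -/

/-- The displayed identity of the proof of Lemma 3.4: z″ − z·z″/(z + z″) = (z″)²/(z″ + z) (z ≥ 0 the photon line's parameter, z″ > 0 the
lepton-path sum). [cite: Volkov2020, §3.2 proof of Lemma 3.4 (journal p.12; tex l.383)] -/
theorem lemma34_parallel_drop (z z'' : ℝ) (hz : 0 ≤ z) (hz'' : 0 < z'') :
    z'' - z * z'' / (z + z'') = z'' ^ 2 / (z'' + z) := by
  have h1 : z + z'' ≠ 0 := by positivity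
  have h2 : z'' + z ≠ 0 := by positivity
  field_simp
  ring

/-- The drop is positive. [cite: Volkov2020, §3.2 proof of Lemma 3.4 (journal p.12)] -/
theorem lemma34_drop_pos (z z'' : ℝ) (hz : 0 ≤ z) (hz'' : 0 < z'') : 0 < z'' ^ 2 / (z'' + z) := by
  positivity

/-- From the printed circuit inequalities "Z(z) ≤ Z_i(z) ≤ Z₀(z)" — here HYPOTHESES on real numbers, with Z_i written in its series–parallel
form Z₀ − z″ + z·z″/(z + z″) — and W = m²(Z − Z₀): |W| ≥ m²·(z″)²/(z″ + z). [cite: Volkov2020, §2.2.2 eq. (2.4) and §3.2 proof of Lemma 3.4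
(journal p.10, p.12; tex l.262–265, l.378–387)] -/
theorem lemma34_W_ge_drop (m Z Z0 z z'' : ℝ) (hz : 0 ≤ z) (hz'' : 0 < z'')
    (hZ : Z ≤ Z0 - z'' + z * z'' / (z + z'')) :
    m ^ 2 * (z'' ^ 2 / (z'' + z)) ≤ |m ^ 2 * (Z - Z0)| := by
  have hdrop := lemma34_parallel_drop z z'' hz hz''
  have h1 : z'' ^ 2 / (z'' + z) ≤ Z0 - Z := by rw [← hdrop]; linarith
  have hm : 0 ≤ m ^ 2 := sq_nonneg m
  calc m ^ 2 * (z'' ^ 2 / (z'' + z)) ≤ m ^ 2 * (Z0 - Z) := mul_le_mul_of_nonneg_left h1 hm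
    _ ≤ |m ^ 2 * (Z - Z0)| := by
        rw [abs_mul, abs_of_nonneg hm, abs_sub_comm]
        exact mul_le_mul_of_nonneg_left (le_abs_self _) hm

/-! ## "max ≤ Σ ≤ n · max" -/

/-- The printed closing remark: for a nonempty finite family of nonnegative reals, max a_i ≤ Σ a_i ≤ n·max a_i (n = the number of terms); with
a = (z_l)_{l∈LPath(i)} this is z′_i ≤ z″_i ≤ |LPath(i)|·z′_i. [cite: Volkov2020, §3.2 proof of Lemma 3.4, last display (journal p.12; tex l.391–394)] -/
theorem lemma34_max_le_sum_le_card_mul_max {ι : Type*} (s : Finset ι) (hs : s.Nonempty) (a : ι → ℝ)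
    (ha : ∀ i ∈ s, 0 ≤ a i) :
    s.sup' hs a ≤ ∑ i ∈ s, a i ∧ ∑ i ∈ s, a i ≤ (s.card : ℝ) * s.sup' hs a := by
  obtain ⟨i, hi, heq⟩ := Finset.exists_mem_eq_sup' hs a
  refine ⟨?_, ?_⟩
  · rw [heq]; exact Finset.single_le_sum ha hi
  · have h := Finset.sum_le_card_nsmul s a (s.sup' hs a) (fun x hx => Finset.le_sup' a hx)
    rw [nsmul_eq_mul] at h
    exact h

/-! ## The comparison (z″)²/(z″ + z) ≍ (z′)²/max(z′, z) -/

/-- a ↦ a²/(a + z) is monotone on a > 0 (z ≥ 0): replacing the path maximum z′ by the larger path sum z″ can only increase the drop.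
[cite: Volkov2020, §3.2 proof of Lemma 3.4 (journal p.12)] -/
theorem sq_div_add_mono {a b z : ℝ} (hz : 0 ≤ z) (ha : 0 < a) (hab : a ≤ b) :
    a ^ 2 / (a + z) ≤ b ^ 2 / (b + z) := by
  have hb : 0 < b := lt_of_lt_of_le ha hab
  rw [div_le_div_iff₀ (by positivity) (by positivity)]
  nlinarith [mul_nonneg (mul_nonneg ha.le hb.le) (sub_nonneg.mpr hab), mul_nonneg hz (sub_nonneg.mpr hab),
    mul_nonneg hz (add_nonneg ha.le hb.le)]

/-- a²/(a + z) ≤ a²/max(a, z), because max(a, z) ≤ a + z. [cite: Volkov2020, §3.2 Lemma 3.4, eq. (3.3) (journal p.12)] -/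
theorem sq_div_add_le_sq_div_max {a z : ℝ} (ha : 0 < a) (hz : 0 ≤ z) :
    a ^ 2 / (a + z) ≤ a ^ 2 / max a z := by
  apply div_le_div_of_nonneg_left (sq_nonneg a) (lt_of_lt_of_le ha (le_max_left a z))
  exact max_le (by linarith) (by linarith)

/-- a²/max(a, z) ≤ 2·a²/(a + z), because a + z ≤ 2·max(a, z). [cite: Volkov2020, §3.2 Lemma 3.4, eq. (3.3) (journal p.12)] -/
theorem sq_div_max_le_two_mul_sq_div_add {a z : ℝ} (ha : 0 < a) (hz : 0 ≤ z) :
    a ^ 2 / max a z ≤ 2 * (a ^ 2 / (a + z)) := by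
  have hmax : 0 < max a z := lt_of_lt_of_le ha (le_max_left a z)
  have hsum : a + z ≤ 2 * max a z := by
    have := le_max_left a z; have := le_max_right a z; linarith
  rw [show 2 * (a ^ 2 / (a + z)) = a ^ 2 / ((a + z) / 2) by field_simp]
  apply div_le_div_of_nonneg_left (sq_nonneg a) (by positivity)
  linarith

/-- LOWER direction, assembled: 0 < z′ ≤ z″ and z ≥ 0 ⇒ (z′)²/max(z′, z) ≤ 2·(z″)²/(z″ + z). [cite: Volkov2020, §3.2 Lemma 3.4 (journal p.12)] -/
theorem lemma34_lower_arith {z' z'' z : ℝ} (hz' : 0 < z') (h1 : z' ≤ z'') (hz : 0 ≤ z) :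
    z' ^ 2 / max z' z ≤ 2 * (z'' ^ 2 / (z'' + z)) :=
  le_trans (sq_div_max_le_two_mul_sq_div_add hz' hz)
    (mul_le_mul_of_nonneg_left (sq_div_add_mono hz hz' h1) (by norm_num))

/-- THE PRINTED FORM (3.3) for the maximising photon i, with the explicit constant C = m²/2: from the circuit hypotheses of `lemma34_W_ge_drop`
and z′ ≤ z″ (path maximum ≤ path sum): (m²/2)·(z′)²/max(z′, z) ≤ |W|. [cite: Volkov2020, §3.2 Lemma 3.4, eq. (3.3) (journal p.12)] -/
theorem lemma34_printed_form (m Z Z0 z z' z'' : ℝ) (hz : 0 ≤ z) (hz' : 0 < z') (h1 : z' ≤ z'')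
    (hZ : Z ≤ Z0 - z'' + z * z'' / (z + z'')) :
    m ^ 2 / 2 * (z' ^ 2 / max z' z) ≤ |m ^ 2 * (Z - Z0)| := by
  have hz'' : 0 < z'' := lt_of_lt_of_le hz' h1
  have hW := lemma34_W_ge_drop m Z Z0 z z'' hz hz'' hZ
  have hlow := lemma34_lower_arith hz' h1 hz
  have hm : 0 ≤ m ^ 2 / 2 := by positivity
  calc m ^ 2 / 2 * (z' ^ 2 / max z' z) ≤ m ^ 2 / 2 * (2 * (z'' ^ 2 / (z'' + z))) := mul_le_mul_of_nonneg_left hlow hm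
    _ = m ^ 2 * (z'' ^ 2 / (z'' + z)) := by ring
    _ ≤ |m ^ 2 * (Z - Z0)| := hW

/-- UPPER direction (the arithmetic skeleton of fn 23 "both directions"): 0 < z′ ≤ z″ ≤ n·z′ and z ≥ 0 ⇒ (z″)²/(z″ + z) ≤ n²·(z′)²/max(z′, z).
[cite: Volkov2020, §3.2 Lemma 3.4 fn 23 (journal p.12)] -/
theorem lemma34_upper_arith {z' z'' z n : ℝ} (hz' : 0 < z') (h1 : z' ≤ z'') (h2 : z'' ≤ n * z') (hz : 0 ≤ z) :
    z'' ^ 2 / (z'' + z) ≤ n ^ 2 * (z' ^ 2 / max z' z) := by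
  have hz'' : 0 < z'' := lt_of_lt_of_le hz' h1
  have hn : 1 ≤ n := by
    by_contra h
    push Not at h
    have : n * z' < 1 * z' := mul_lt_mul_of_pos_right h hz'
    linarith
  have hmax : 0 < max z' z := lt_of_lt_of_le hz' (le_max_left _ _)
  have hmax_le : max z' z ≤ z'' + z := max_le (by linarith) (by linarith)
  -- numerator: z″² ≤ (n z′)²; denominator: z″ + z ≥ max(z′, z)
  calc z'' ^ 2 / (z'' + z) ≤ (n * z') ^ 2 / (z'' + z) := by
        apply div_le_div_of_nonneg_right _ (by positivity)
        exact pow_le_pow_left₀ hz''.le h2 2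
    _ ≤ (n * z') ^ 2 / max z' z := div_le_div_of_nonneg_left (sq_nonneg _) hmax hmax_le
    _ = n ^ 2 * (z' ^ 2 / max z' z) := by ring

end Literature.MathematicalPhysics.QuantumFieldTheory.Volkov2020
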